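/-
Copyright (c) 2026 the pub-hodgecm-mathlib formalisation cell (harness21).  Prover seat hodgecm-mathlib-F0P3a-p01 (g31), req620 Track A «(D-RAM) FOUR-FRAME» squad
(unit U3_Laws, MS ROAD A; brick 5a «type-2 row-ideal pinch» dealt by the MS first seat LH4-p11 (g0) 2026-09-03T22:52:56Z; dealer LH4-plan (g10)).  2026-09-03.
-/
import Summits.HodgeConjecture.HodgeConjecture.Theorems.F0P3cDyRamDiagonalDualisableExponents  -- ★ p855394 (this seat): `v_dualFrame_apply`, `rowSup_eq_of_latt_eq`; brings ★ p855301 `dualLatt_diagonal_latt_hnf`, ★ p855324 row ideals, ★ p855307 `dualLatt_diagonal_eq_mapGL`∕`coe_inv_diagonal`, ★ Apartment `mem_mapGL_iff`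
import Literature.NumberTheory.Automorphic.UnitaryLatticeTreeTypes                             -- ★ (B-p14): `le_dualLatt_of_isVertexLattice`, `scaleLattice_dualLatt_le_of_isVertexLattice`, `mem_scaleLattice_iff`
import Mathlib.Algebra.Ring.Int.Parity                                                          -- `Int.two_mul_ediv_two_of_even`, `Int.two_mul_ediv_two_add_one_of_odd`
import HarnessLib

/-!
# Crux `H413`, line LH4 «(D-RAM) FOUR-FRAME» road — unit U3_Laws (iii), MS ROAD A brick 5a: THE TYPE-2 ROW-IDEAL PINCH
# (for a vertex lattice `M` of ANY type for a diagonal form `diag(D)`: `|ϖ|·|pr_i(M^{♯_1})| ≤ |D_i|·|pr_i(M)| ≤ |pr_i(M^{♯_1})|`; at a normalised slot `|D_i| ∈ {s_i, |ϖ|s_i}`,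
# and the parity of `v(D_i)` pins it — MEMO-stableLaw-finite §2.5 «the valuation vector of `D` is FORCED: `v(d_i) ∈ {m_i, m_i + 1}`, the even one»)

Cell `hodgecm-mathlib` (D-0151), FLOOR 0, crux item H413 = `stmt-HodgeConjecture-24833`, route of record `HCCMUnconditional`; squad F0∕P3c∕LH4 (req618∕req620).  THEOREMS ONLY
(no `def`, no instance, no notation, no `sorry`, default heartbeats); lane `--supports stmt-HodgeConjecture-24833 --as helper` (count-neutral).  Target of the road: U3 ED. 4∕5 §S-R
`stub_U3_stableModelSum` ((MS), both vertex types); finite form (S-fin)₂ in `F0/P3c/LH4/LH4-p10/g0/MEMO-stableLaw-finite.v1.LH4p10g0.md` §2.5; brick list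
`F0/P3c/LH4/LH4-p11/g0/MS-ROAD-A-BRICKS.v2.LH4p11g0.md` item 5 (this is its first half; the co-length-2 fibre count `μ(F₂(M))` stays with the MS seats).

WHAT IS PROVED (generic valued field `K`, `σ` valuation-preserving, `D_i ≠ 0`, `ϖ ≠ 0`; the vertex TYPE `d` is FREE — the sandwich `ϖ·M^{♯_D} ≤ M ≤ M^{♯_D}` holds for every type,
type `2` is the use case, at type `0` ★ p855394 gives the sharper equality).
* §1 FRAME-FREE, any lattice `M`: `dualLatt_one_eq_mapGL_dualLatt_diagonal` (`M^{♯_1} = diag(D)·M^{♯_D}`, ★ p855307 §1 at `d′ := 1`); `diagonal_mul_mem_dualLatt_one_of_mem`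
  (`m ∈ M ⇒ D·m ∈ M^{♯_1}`, from `M ≤ M^{♯_D}`); `smul_diagonal_inv_mul_mem_of_mem_dualLatt_one` (`w ∈ M^{♯_1} ⇒ ϖ·D⁻¹·w ∈ M`, from `ϖ·M^{♯_D} ≤ M`); slot forms
  `exists_mem_dualLatt_one_v_eq_mul` (`pr_i(M)` attains `s` ⇒ `pr_i(M^{♯_1})` attains `|D_i|·s`) and `v_mul_le_of_mem_dualLatt_one` (`pr_i(M) ≤ s` ⇒ `|ϖ|·|w_i| ≤ |D_i|·s` on `M^{♯_1}`).
* §2 HNF FRAME FORM (LH4-p11's two inequalities verbatim), `V = [[1,0,0],[x,ϖ^b,0],[y,z,ϖ^c]]`, `U_1 = ((σV)ᵀ)⁻¹` the explicit dual frame for the standard form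
  (`dualLatt_one_latt_hnf : (latt V)^{♯_1} = latt U_1`, ★ p855301 at `d := 1`):  **`|ϖ|·max_j |(U_1)_{ij}| ≤ |D_i|·max_j |V_{ij}|`** and **`|D_i|·max_j |V_{ij}| ≤ max_j |(U_1)_{ij}|`**.
* §3 NORMALISED SLOT (`max_j |V_{ij}| = 1`): `|ϖ|·s₁ ≤ |D_i| ≤ s₁` (`s₁ := max_j |(U_1)_{ij}|`); with `ϖ` a uniformiser (`v ϖ = exp(−1)`, datum clause) the DICHOTOMY
  `|D_i| = s₁ ∨ |D_i| = |ϖ|·s₁`; and with the datum's parity currency (`v(D_i) = exp(2n)` — every `σ`-fixed non-zero element has even valuation at a ramified datum) and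
  `s₁ = exp m`:  **`v(D_i) = exp(2·⌊m∕2⌋)`** — «the even one of `{m, m − 1}`» (`v_eq_exp_two_mul_ediv_two_of_isVertexLattice_of_rowSup_eq_one`).
THE MATHEMATICS ([Jacobowitz1962, §4, §7–§8]; [Serre1980Trees, II §1.1]).  A vertex lattice of type `d` satisfies `ϖM^♯ ⊆ M ⊆ M^♯` for its own form; `M^{♯_1} = D·M^{♯_D}` for
`h_D(x,y) = h_1(x, Dy)`; coordinates scale by `D_i`; row ideals of `latt g` are `(max_j |g_{ij}|)` (★ p855324); the value group is `ℤ` so an interval `[|ϖ|s, s]` has two points.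
HONEST LABEL.  Count-neutral (`--supports`); nothing printed is asserted; (MS) stays a PROVER TARGET; the verdict of record for (D-RAM) stays PRINT [LanglandsShelstad1989 Thm. p. 484 ∕
Rogawski1990 Prop. 4.9.1 (a)] ∕ XL; `HC_CM` is proved only modulo the 7 printed citations (2 remaining named inputs: hLiu418 = `stmt-HodgeConjecture-24832`, h413 =
`stmt-HodgeConjecture-24833`) until rung 0 closes.

## References
* [Jacobowitz1962] R. Jacobowitz, *Hermitian forms over local fields*, Amer. J. Math. 84 (1962), §4 (duals under a change of form), §7–§8 (unimodular and `ϖ`-modular lattices).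
* [Serre1980Trees] J.-P. Serre, *Trees* (1980), Ch. II §1.1 (lattices `g·𝒪^N`, invariants of a lattice).
* [Kottwitz1986BaseChangeUnits] R. E. Kottwitz, *Base change for unit elements of Hecke algebras*, Compositio Math. 60 (1986), §1 pp. 240–241 (normalised representatives).
-/

set_option autoImplicit false

noncomputable section

namespace Summit.HodgeConjecture.HodgeConjecture.Cruxes.H413.F0P3cDyRamDiagonalTypeTwoRowPinch

open Matrix
open Literature.NumberTheory.Automorphic Literature.NumberTheory.Automorphic.HermitianLattice Literature.NumberTheory.Automorphic.UnitaryGroup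
open Literature.NumberTheory.Automorphic.UnitaryLatticeTree
open Summit.HodgeConjecture.HodgeConjecture.Cruxes.H413.F0P3cDyRamDiagonalHNFDual
open Summit.HodgeConjecture.HodgeConjecture.Cruxes.H413.F0P3cDyRamLattRowIdeal
open Summit.HodgeConjecture.HodgeConjecture.Cruxes.H413.F0P3cDyRamDiagonalSelfDualFibre
open Summit.HodgeConjecture.HodgeConjecture.Cruxes.H413.F0P3cDyRamDiagonalDualisableExponents
open scoped Valued WithZero Matrix MatrixGroups

variable {K : Type*} [Field K] [Valued K ℤᵐ⁰]

/-! ## §1  Frame-free: `M^{♯_1} = diag(D)·M^{♯_D}` and the sandwich `ϖ·M^{♯_D} ≤ M ≤ M^{♯_D}` -/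

/-- **`M^{♯_1} = diag(D)·M^{♯_D}`** for any `𝒪`-submodule `M` and any diagonal form `diag(D)` with `D_i ≠ 0` (★ p855307 `dualLatt_diagonal_eq_mapGL` at `d′ := 1`).
[cite: Jacobowitz1962, §4] -/
theorem dualLatt_one_eq_mapGL_dualLatt_diagonal (σ : K →+* K) {D : Fin 3 → K} (hD : ∀ i, D i ≠ 0) (M : Submodule 𝒪[K] (Fin 3 → K))
    (U : GL (Fin 3) K) (hU : (U : Matrix (Fin 3) (Fin 3) K) = Matrix.diagonal D) :
    dualLatt σ (1 : Matrix (Fin 3) (Fin 3) K) M = mapGL U (dualLatt σ (Matrix.diagonal D) M) := by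
  have hU' : (U : Matrix (Fin 3) (Fin 3) K) = Matrix.diagonal fun i => D i / (fun _ : Fin 3 => (1 : K)) i := by
    rw [hU]; simp only [div_one]
  have h := dualLatt_diagonal_eq_mapGL σ (d := D) (d' := fun _ : Fin 3 => (1 : K)) hD (fun _ => one_ne_zero) M U hU'
  rw [Matrix.diagonal_one] at h
  exact h

/-- **`m ∈ M ⇒ D·m ∈ M^{♯_1}`** for a vertex lattice `M` (any type) of `diag(D)`: `M ≤ M^{♯_D}` (★ `le_dualLatt_of_isVertexLattice`) and `M^{♯_1} = diag(D)·M^{♯_D}`.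
[cite: Jacobowitz1962, §4, §7–§8] -/
theorem diagonal_mul_mem_dualLatt_one_of_mem {σ : K →+* K} (hvσ : ∀ a, Valued.v (σ a) = Valued.v a) {ϖ : K} {D : Fin 3 → K} (hD : ∀ i, D i ≠ 0)
    {d : ℕ} {M : Submodule 𝒪[K] (Fin 3 → K)} (hM : IsVertexLattice σ ϖ (Matrix.diagonal D) d M) {m : Fin 3 → K} (hm : m ∈ M) :
    (fun i => D i * m i) ∈ dualLatt σ (1 : Matrix (Fin 3) (Fin 3) K) M := by
  have hH : IsUnit (Matrix.diagonal D).det := by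
    rw [Matrix.det_diagonal]; exact (Finset.prod_ne_zero_iff.2 fun i _ => hD i).isUnit
  set U : GL (Fin 3) K := Matrix.nonsingInvUnit (Matrix.diagonal D) hH with hU_def
  have hU : (U : Matrix (Fin 3) (Fin 3) K) = Matrix.diagonal D := rfl
  have hm' : m ∈ dualLatt σ (Matrix.diagonal D) M := le_dualLatt_of_isVertexLattice hvσ hM hm
  rw [dualLatt_one_eq_mapGL_dualLatt_diagonal σ hD M U hU]
  have hvec : (fun i => D i * m i) = (U : Matrix (Fin 3) (Fin 3) K).mulVec m := by
    funext i; rw [hU, Matrix.mulVec_diagonal]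
  rw [hvec]
  exact Submodule.mem_map.2 ⟨m, hm', by rw [LinearMap.restrictScalars_apply, Matrix.toLin'_apply]⟩

/-- **`w ∈ M^{♯_1} ⇒ ϖ·D⁻¹·w ∈ M`** for a vertex lattice `M` (any type) of `diag(D)` (`ϖ ≠ 0`): `D⁻¹·w ∈ M^{♯_D}` and `ϖ·M^{♯_D} ≤ M` (★ `scaleLattice_dualLatt_le_of_isVertexLattice`).
[cite: Jacobowitz1962, §4, §7–§8] -/
theorem smul_diagonal_inv_mul_mem_of_mem_dualLatt_one {σ : K →+* K} (hvσ : ∀ a, Valued.v (σ a) = Valued.v a) {ϖ : K} (hϖ : ϖ ≠ 0) {D : Fin 3 → K} (hD : ∀ i, D i ≠ 0)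
    {d : ℕ} {M : Submodule 𝒪[K] (Fin 3 → K)} (hM : IsVertexLattice σ ϖ (Matrix.diagonal D) d M) {w : Fin 3 → K}
    (hw : w ∈ dualLatt σ (1 : Matrix (Fin 3) (Fin 3) K) M) :
    (fun i => ϖ * ((D i)⁻¹ * w i)) ∈ M := by
  have hH : IsUnit (Matrix.diagonal D).det := by
    rw [Matrix.det_diagonal]; exact (Finset.prod_ne_zero_iff.2 fun i _ => hD i).isUnit
  set U : GL (Fin 3) K := Matrix.nonsingInvUnit (Matrix.diagonal D) hH with hU_def
  have hU : (U : Matrix (Fin 3) (Fin 3) K) = Matrix.diagonal D := rfl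
  rw [dualLatt_one_eq_mapGL_dualLatt_diagonal σ hD M U hU, mem_mapGL_iff, coe_inv_diagonal hD U hU] at hw
  -- `hw : (diagonal D⁻¹).mulVec w ∈ M^{♯_D}`; scale by `ϖ`
  have hsc : ϖ • (Matrix.diagonal fun i => (D i)⁻¹).mulVec w ∈ scaleLattice ϖ (dualLatt σ (Matrix.diagonal D) M) := by
    rw [mem_scaleLattice_iff hϖ, smul_smul, inv_mul_cancel₀ hϖ, one_smul]
    exact hw
  have hmem := scaleLattice_dualLatt_le_of_isVertexLattice hvσ hH hM hsc
  have hvec : (fun i => ϖ * ((D i)⁻¹ * w i)) = ϖ • (Matrix.diagonal fun i => (D i)⁻¹).mulVec w := by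
    funext i; rw [Pi.smul_apply, smul_eq_mul, Matrix.mulVec_diagonal]
  rw [hvec]
  exact hmem

/-- **Slot form, lower pinch**: if `pr_i(M)` attains the value `s`, then `pr_i(M^{♯_1})` attains `|D_i|·s`. [cite: Jacobowitz1962, §4, §7–§8] -/
theorem exists_mem_dualLatt_one_v_eq_mul {σ : K →+* K} (hvσ : ∀ a, Valued.v (σ a) = Valued.v a) {ϖ : K} {D : Fin 3 → K} (hD : ∀ i, D i ≠ 0)
    {d : ℕ} {M : Submodule 𝒪[K] (Fin 3 → K)} (hM : IsVertexLattice σ ϖ (Matrix.diagonal D) d M) (i : Fin 3) {s : ℤᵐ⁰}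
    (hex : ∃ m ∈ M, Valued.v (m i) = s) :
    ∃ w ∈ dualLatt σ (1 : Matrix (Fin 3) (Fin 3) K) M, Valued.v (w i) = Valued.v (D i) * s := by
  obtain ⟨m, hm, hmi⟩ := hex
  exact ⟨fun j => D j * m j, diagonal_mul_mem_dualLatt_one_of_mem hvσ hD hM hm, by rw [map_mul, hmi]⟩

/-- **Slot form, upper pinch**: if `|m_i| ≤ s` on `M`, then `|ϖ|·|w_i| ≤ |D_i|·s` on `M^{♯_1}`. [cite: Jacobowitz1962, §4, §7–§8] -/
theorem v_mul_le_of_mem_dualLatt_one {σ : K →+* K} (hvσ : ∀ a, Valued.v (σ a) = Valued.v a) {ϖ : K} (hϖ : ϖ ≠ 0) {D : Fin 3 → K} (hD : ∀ i, D i ≠ 0)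
    {d : ℕ} {M : Submodule 𝒪[K] (Fin 3 → K)} (hM : IsVertexLattice σ ϖ (Matrix.diagonal D) d M) (i : Fin 3) {s : ℤᵐ⁰}
    (hle : ∀ m ∈ M, Valued.v (m i) ≤ s) {w : Fin 3 → K} (hw : w ∈ dualLatt σ (1 : Matrix (Fin 3) (Fin 3) K) M) :
    Valued.v ϖ * Valued.v (w i) ≤ Valued.v (D i) * s := by
  have hDi : Valued.v (D i) ≠ 0 := (Valuation.ne_zero_iff _).2 (hD i)
  have h := hle _ (smul_diagonal_inv_mul_mem_of_mem_dualLatt_one hvσ hϖ hD hM hw)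
  simp only [map_mul, map_inv₀] at h
  calc Valued.v ϖ * Valued.v (w i) = Valued.v (D i) * (Valued.v ϖ * ((Valued.v (D i))⁻¹ * Valued.v (w i))) := by
        rw [mul_left_comm (Valued.v ϖ), ← mul_assoc (Valued.v (D i)), mul_inv_cancel₀ hDi, one_mul]
    _ ≤ Valued.v (D i) * s := by gcongr

/-! ## §2  The HNF frame form: the two inequalities on row maxima -/

/-- `(latt V)^{♯_1} = latt U_1` for the HNF frame `V` and the explicit `U_1 = ((σV)ᵀ)⁻¹` (★ p855301 `dualLatt_diagonal_latt_hnf` at `d := 1`). [cite: Jacobowitz1962, §4] -/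
theorem dualLatt_one_latt_hnf (σ : K →+* K) (hvσ : ∀ a, Valued.v (σ a) = Valued.v a) {ϖ : K} (hϖ : ϖ ≠ 0) (x y z : K) (b c : ℕ) :
    dualLatt σ (1 : Matrix (Fin 3) (Fin 3) K) (latt (!![1, 0, 0; x, ϖ ^ b, 0; y, z, ϖ ^ c] : Matrix (Fin 3) (Fin 3) K)) =
      latt (!![1, -σ x * (σ ϖ ^ b)⁻¹, (σ x * σ z * (σ ϖ ^ b)⁻¹ - σ y) * (σ ϖ ^ c)⁻¹;
              0, (σ ϖ ^ b)⁻¹, -σ z * (σ ϖ ^ b)⁻¹ * (σ ϖ ^ c)⁻¹;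
              0, 0, (σ ϖ ^ c)⁻¹] : Matrix (Fin 3) (Fin 3) K) := by
  rw [← Matrix.diagonal_one, dualLatt_diagonal_latt_hnf σ hvσ hϖ (d := fun _ : Fin 3 => (1 : K)) (fun _ => one_ne_zero) x y z b c]
  congr 1
  ext i j
  fin_cases i <;> fin_cases j <;> simp

/-- **«TYPE-2 ROW-IDEAL PINCH», LOWER HALF: `|D_i|·max_j |V_{ij}| ≤ max_j |(U_1)_{ij}|`** for a vertex lattice `latt V` (any type) of `diag(D)`: the row maximum of `V` is attained
on `latt V`, and `D·(latt V) ⊆ (latt V)^{♯_1} = latt U_1`. [cite: Jacobowitz1962, §4, §7–§8] [cite: Serre1980Trees, II §1.1] -/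
theorem v_mul_rowSup_le_rowSup_dualOne {σ : K →+* K} (hvσ : ∀ a, Valued.v (σ a) = Valued.v a) {ϖ : K} (hϖ : ϖ ≠ 0)
    {D : Fin 3 → K} (hD : ∀ i, D i ≠ 0) (x y z : K) (b c : ℕ) {d : ℕ}
    (hM : IsVertexLattice σ ϖ (Matrix.diagonal D) d (latt (!![1, 0, 0; x, ϖ ^ b, 0; y, z, ϖ ^ c] : Matrix (Fin 3) (Fin 3) K))) (i : Fin 3) :
    Valued.v (D i) * Finset.univ.sup' Finset.univ_nonempty (fun j => Valued.v ((!![1, 0, 0; x, ϖ ^ b, 0; y, z, ϖ ^ c] : Matrix (Fin 3) (Fin 3) K) i j)) ≤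
      Finset.univ.sup' Finset.univ_nonempty (fun j => Valued.v
        ((!![1, -σ x * (σ ϖ ^ b)⁻¹, (σ x * σ z * (σ ϖ ^ b)⁻¹ - σ y) * (σ ϖ ^ c)⁻¹;
            0, (σ ϖ ^ b)⁻¹, -σ z * (σ ϖ ^ b)⁻¹ * (σ ϖ ^ c)⁻¹;
            0, 0, (σ ϖ ^ c)⁻¹] : Matrix (Fin 3) (Fin 3) K) i j)) := by
  obtain ⟨w, hw, hwi⟩ := exists_mem_dualLatt_one_v_eq_mul hvσ hD hM i (exists_mem_latt_v_apply_eq_sup _ i)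
  rw [dualLatt_one_latt_hnf σ hvσ hϖ x y z b c] at hw
  rw [← hwi]
  exact v_apply_le_sup_of_mem_latt _ i hw

/-- **«TYPE-2 ROW-IDEAL PINCH», UPPER HALF: `|ϖ|·max_j |(U_1)_{ij}| ≤ |D_i|·max_j |V_{ij}|`** for a vertex lattice `latt V` (any type) of `diag(D)`: the row maximum of `U_1` is
attained on `latt U_1 = (latt V)^{♯_1}`, and `ϖ·D⁻¹·(latt V)^{♯_1} ⊆ latt V`. [cite: Jacobowitz1962, §4, §7–§8] [cite: Serre1980Trees, II §1.1] -/
theorem v_mul_rowSup_dualOne_le_v_mul_rowSup {σ : K →+* K} (hvσ : ∀ a, Valued.v (σ a) = Valued.v a) {ϖ : K} (hϖ : ϖ ≠ 0)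
    {D : Fin 3 → K} (hD : ∀ i, D i ≠ 0) (x y z : K) (b c : ℕ) {d : ℕ}
    (hM : IsVertexLattice σ ϖ (Matrix.diagonal D) d (latt (!![1, 0, 0; x, ϖ ^ b, 0; y, z, ϖ ^ c] : Matrix (Fin 3) (Fin 3) K))) (i : Fin 3) :
    Valued.v ϖ * Finset.univ.sup' Finset.univ_nonempty (fun j => Valued.v
        ((!![1, -σ x * (σ ϖ ^ b)⁻¹, (σ x * σ z * (σ ϖ ^ b)⁻¹ - σ y) * (σ ϖ ^ c)⁻¹;
            0, (σ ϖ ^ b)⁻¹, -σ z * (σ ϖ ^ b)⁻¹ * (σ ϖ ^ c)⁻¹;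
            0, 0, (σ ϖ ^ c)⁻¹] : Matrix (Fin 3) (Fin 3) K) i j)) ≤
      Valued.v (D i) * Finset.univ.sup' Finset.univ_nonempty (fun j => Valued.v ((!![1, 0, 0; x, ϖ ^ b, 0; y, z, ϖ ^ c] : Matrix (Fin 3) (Fin 3) K) i j)) := by
  obtain ⟨w, hw, hwi⟩ := exists_mem_latt_v_apply_eq_sup
    (!![1, -σ x * (σ ϖ ^ b)⁻¹, (σ x * σ z * (σ ϖ ^ b)⁻¹ - σ y) * (σ ϖ ^ c)⁻¹;
        0, (σ ϖ ^ b)⁻¹, -σ z * (σ ϖ ^ b)⁻¹ * (σ ϖ ^ c)⁻¹;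
        0, 0, (σ ϖ ^ c)⁻¹] : Matrix (Fin 3) (Fin 3) K) i
  rw [← dualLatt_one_latt_hnf σ hvσ hϖ x y z b c] at hw
  rw [← hwi]
  exact v_mul_le_of_mem_dualLatt_one hvσ hϖ hD hM i (fun m hm => v_apply_le_sup_of_mem_latt _ i hm) hw

/-! ## §3  At a normalised slot: `|ϖ|·s₁ ≤ |D_i| ≤ s₁`, the dichotomy, and the parity pin -/

/-- **NORMALISED SLOT**: if the `i`-th row maximum of `V` is `1` (`pr_i(latt V) = 𝒪`), then `|ϖ|·s₁ ≤ |D_i| ≤ s₁` with `s₁ = max_j |(U_1)_{ij}|`.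
[cite: Jacobowitz1962, §4, §7–§8] [cite: Kottwitz1986BaseChangeUnits, §1 pp. 240–241] -/
theorem v_mem_Icc_of_isVertexLattice_of_rowSup_eq_one {σ : K →+* K} (hvσ : ∀ a, Valued.v (σ a) = Valued.v a) {ϖ : K} (hϖ : ϖ ≠ 0)
    {D : Fin 3 → K} (hD : ∀ i, D i ≠ 0) (x y z : K) (b c : ℕ) {d : ℕ}
    (hM : IsVertexLattice σ ϖ (Matrix.diagonal D) d (latt (!![1, 0, 0; x, ϖ ^ b, 0; y, z, ϖ ^ c] : Matrix (Fin 3) (Fin 3) K))) (i : Fin 3)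
    (hN : Finset.univ.sup' Finset.univ_nonempty (fun j => Valued.v ((!![1, 0, 0; x, ϖ ^ b, 0; y, z, ϖ ^ c] : Matrix (Fin 3) (Fin 3) K) i j)) = 1) :
    Valued.v ϖ * Finset.univ.sup' Finset.univ_nonempty (fun j => Valued.v
        ((!![1, -σ x * (σ ϖ ^ b)⁻¹, (σ x * σ z * (σ ϖ ^ b)⁻¹ - σ y) * (σ ϖ ^ c)⁻¹;
            0, (σ ϖ ^ b)⁻¹, -σ z * (σ ϖ ^ b)⁻¹ * (σ ϖ ^ c)⁻¹;
            0, 0, (σ ϖ ^ c)⁻¹] : Matrix (Fin 3) (Fin 3) K) i j)) ≤ Valued.v (D i) ∧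
      Valued.v (D i) ≤ Finset.univ.sup' Finset.univ_nonempty (fun j => Valued.v
        ((!![1, -σ x * (σ ϖ ^ b)⁻¹, (σ x * σ z * (σ ϖ ^ b)⁻¹ - σ y) * (σ ϖ ^ c)⁻¹;
            0, (σ ϖ ^ b)⁻¹, -σ z * (σ ϖ ^ b)⁻¹ * (σ ϖ ^ c)⁻¹;
            0, 0, (σ ϖ ^ c)⁻¹] : Matrix (Fin 3) (Fin 3) K) i j)) := by
  have h1 := v_mul_rowSup_dualOne_le_v_mul_rowSup hvσ hϖ hD x y z b c hM i
  have h2 := v_mul_rowSup_le_rowSup_dualOne hvσ hϖ hD x y z b c hM i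
  rw [hN, mul_one] at h1 h2
  exact ⟨h1, h2⟩

/-- **THE VALUE GROUP IS `ℤ`: an interval `[exp(−1)·s, s]` has two points.**  For `x, s ∈ ℤᵐ⁰` with `x ≠ 0` and `exp(−1)·s ≤ x ≤ s`: `x = s ∨ x = exp(−1)·s`.
[cite: Serre1980Trees, II §1.1] -/
theorem eq_or_eq_exp_neg_one_mul_of_le_of_le {x s : ℤᵐ⁰} (hx : x ≠ 0) (h1 : WithZero.exp (-1 : ℤ) * s ≤ x) (h2 : x ≤ s) :
    x = s ∨ x = WithZero.exp (-1 : ℤ) * s := by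
  have hs : s ≠ 0 := fun hs => hx (le_antisymm (hs ▸ h2) zero_le)
  obtain ⟨a, rfl⟩ : ∃ a : ℤ, x = WithZero.exp a := ⟨WithZero.log x, (WithZero.exp_log hx).symm⟩
  obtain ⟨m, rfl⟩ : ∃ m : ℤ, s = WithZero.exp m := ⟨WithZero.log s, (WithZero.exp_log hs).symm⟩
  rw [← WithZero.exp_add, WithZero.exp_le_exp] at h1
  rw [WithZero.exp_le_exp] at h2
  rw [← WithZero.exp_add, WithZero.exp_inj, WithZero.exp_inj]
  omega

/-- **DICHOTOMY at a normalised slot with `ϖ` a uniformiser** (`v ϖ = exp(−1)`, datum clause (3)): `|D_i| = s₁` or `|D_i| = |ϖ|·s₁`.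
[cite: Jacobowitz1962, §7–§8] [cite: Kottwitz1986BaseChangeUnits, §1 pp. 240–241] -/
theorem v_eq_or_eq_of_isVertexLattice_of_rowSup_eq_one {σ : K →+* K} (hvσ : ∀ a, Valued.v (σ a) = Valued.v a) {ϖ : K}
    (hϖ1 : Valued.v ϖ = WithZero.exp (-1 : ℤ)) {D : Fin 3 → K} (hD : ∀ i, D i ≠ 0) (x y z : K) (b c : ℕ) {d : ℕ}
    (hM : IsVertexLattice σ ϖ (Matrix.diagonal D) d (latt (!![1, 0, 0; x, ϖ ^ b, 0; y, z, ϖ ^ c] : Matrix (Fin 3) (Fin 3) K))) (i : Fin 3)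
    (hN : Finset.univ.sup' Finset.univ_nonempty (fun j => Valued.v ((!![1, 0, 0; x, ϖ ^ b, 0; y, z, ϖ ^ c] : Matrix (Fin 3) (Fin 3) K) i j)) = 1) :
    Valued.v (D i) = Finset.univ.sup' Finset.univ_nonempty (fun j => Valued.v
        ((!![1, -σ x * (σ ϖ ^ b)⁻¹, (σ x * σ z * (σ ϖ ^ b)⁻¹ - σ y) * (σ ϖ ^ c)⁻¹;
            0, (σ ϖ ^ b)⁻¹, -σ z * (σ ϖ ^ b)⁻¹ * (σ ϖ ^ c)⁻¹;
            0, 0, (σ ϖ ^ c)⁻¹] : Matrix (Fin 3) (Fin 3) K) i j)) ∨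
      Valued.v (D i) = Valued.v ϖ * Finset.univ.sup' Finset.univ_nonempty (fun j => Valued.v
        ((!![1, -σ x * (σ ϖ ^ b)⁻¹, (σ x * σ z * (σ ϖ ^ b)⁻¹ - σ y) * (σ ϖ ^ c)⁻¹;
            0, (σ ϖ ^ b)⁻¹, -σ z * (σ ϖ ^ b)⁻¹ * (σ ϖ ^ c)⁻¹;
            0, 0, (σ ϖ ^ c)⁻¹] : Matrix (Fin 3) (Fin 3) K) i j)) := by
  have hϖ : ϖ ≠ 0 := fun h0 => by rw [h0, map_zero] at hϖ1; exact WithZero.exp_ne_zero hϖ1.symm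
  have h := v_mem_Icc_of_isVertexLattice_of_rowSup_eq_one hvσ hϖ hD x y z b c hM i hN
  rw [hϖ1] at h ⊢
  exact eq_or_eq_exp_neg_one_mul_of_le_of_le ((Valuation.ne_zero_iff _).2 (hD i)) h.1 h.2

/-- **PARITY PIN (`v_eq_of_isVertexLattice_two_of_normalised` of the brick list).**  At a normalised slot, with `ϖ` a uniformiser, `s₁ = exp m`, and `v(D_i)` EVEN (the datum's
parity currency: `σ`-fixed non-zero elements have even valuation at a ramified quadratic datum):  `v(D_i) = exp(2·⌊m∕2⌋)` — the even one of `{m, m − 1}`.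
[cite: Jacobowitz1962, §7–§8] [cite: Kottwitz1986BaseChangeUnits, §1 pp. 240–241] -/
theorem v_eq_exp_two_mul_ediv_two_of_isVertexLattice_of_rowSup_eq_one {σ : K →+* K} (hvσ : ∀ a, Valued.v (σ a) = Valued.v a) {ϖ : K}
    (hϖ1 : Valued.v ϖ = WithZero.exp (-1 : ℤ)) {D : Fin 3 → K} (hD : ∀ i, D i ≠ 0) (x y z : K) (b c : ℕ) {d : ℕ}
    (hM : IsVertexLattice σ ϖ (Matrix.diagonal D) d (latt (!![1, 0, 0; x, ϖ ^ b, 0; y, z, ϖ ^ c] : Matrix (Fin 3) (Fin 3) K))) (i : Fin 3)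
    (hN : Finset.univ.sup' Finset.univ_nonempty (fun j => Valued.v ((!![1, 0, 0; x, ϖ ^ b, 0; y, z, ϖ ^ c] : Matrix (Fin 3) (Fin 3) K) i j)) = 1)
    {m : ℤ} (hs : Finset.univ.sup' Finset.univ_nonempty (fun j => Valued.v
        ((!![1, -σ x * (σ ϖ ^ b)⁻¹, (σ x * σ z * (σ ϖ ^ b)⁻¹ - σ y) * (σ ϖ ^ c)⁻¹;
            0, (σ ϖ ^ b)⁻¹, -σ z * (σ ϖ ^ b)⁻¹ * (σ ϖ ^ c)⁻¹;
            0, 0, (σ ϖ ^ c)⁻¹] : Matrix (Fin 3) (Fin 3) K) i j)) = WithZero.exp m)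
    (heven : ∃ n : ℤ, Valued.v (D i) = WithZero.exp (2 * n)) :
    Valued.v (D i) = WithZero.exp (2 * (m / 2)) := by
  obtain ⟨n, hn⟩ := heven
  have h := v_eq_or_eq_of_isVertexLattice_of_rowSup_eq_one hvσ hϖ1 hD x y z b c hM i hN
  rw [hs, hϖ1, ← WithZero.exp_add, hn, WithZero.exp_inj, WithZero.exp_inj] at h
  rw [hn, WithZero.exp_inj]
  rcases h with h | h
  · rw [← h, Int.two_mul_ediv_two_of_even ⟨n, by omega⟩]
  · have hodd : Odd m := ⟨n, by omega⟩
    have := Int.two_mul_ediv_two_add_one_of_odd hodd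
    omega

end Summit.HodgeConjecture.HodgeConjecture.Cruxes.H413.F0P3cDyRamDiagonalTypeTwoRowPinch

end
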